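import Mathlib
import Summits.Ventures.PercRepro2.LeafRowPendantRootMirrorB
import Summits.Ventures.PercRepro2.StarTwoEdges
import Summits.Ventures.PercRepro2.PinTwo

/-!
# The masses at a vertex adjacent exactly to `o` and `b`, and the star inequality
(blind cell PercRepro2, p5 g31; `proofs/P5-OEDGE.md` §41 (3))

Let the only edges at `v` be `e₁ = {v, o}` (weight `u`) and `e₂ = {v, b}` (weight `w`), and
write `P₀₀` for the law with both edges closed (`v` isolated; the «`G − v`» law).  The
`v`-masses of the second-order mirror (A)-term factor through the two edges (the STAR CLOSURE):
`P(Q, vL, oH, bH) = 0` (**`prob_vL_oH_bH`**), `P(Q, vL, oH) = (1 − u)·w·P₀₀(Q, oH, bL)`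
(**`prob_vL_oH`**: the edge `ov` must be closed and `bv` open), and symmetrically
(**`prob_vL_bH`**); `P(Q, oH) ≥ (1 − uw)·P₀₀(Q, oH) + uw·P₀₀(Q, oH, ¬bL)` (**`prob_oH_ge`**,
three disjoint edge patterns, the both-open one through `StarTwoEdges.conn_of_conn_update_open`)
and `π_v ≥ u·P₀₀(oL) + w·P₀₀(bL) − uw·P₀₀(oL, bL)` (**`prob_vL_ge`**, inclusion–exclusion).
The sign then reduces to the STAR INEQUALITY **`star_ineq`**
`(1 − uwα)(1 − u)wβ + (1 − uwβ)u(1 − w)α ≤ (1 − uwβ)(1 − uwα)(uα + wβ − uwγ)` for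
`γ ≤ min(α, β)`, proved by an explicit certificate.  The sign itself is
`LeafRowPendantRootStarOB.crossA'so_nonneg_of_star`.  Own work; standard axioms.
-/

namespace Summit.Ventures.PercRepro2

open UnionCluster CovForm CovForm.FirstOrder LeafStep LeafHalfCross LeafRowEdgeCubic
  LeafRowFirstOrderA LeafRowPendantRootFO LeafRowPendantRootSO LeafRowPendantRootMirrorB
  StarTwoEdges PinTwo

namespace LeafRowPendantRootStarMasses

/-! ## The star inequality -/

section Star

variable {R : Type*} [Field R] [LinearOrder R] [IsStrictOrderedRing R]

/-- The star inequality in the case `α ≤ β`: its bracket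
`β(1 − uwα)(1 − wβ) + α(1 − uwβ)(1 − uα) − γ(1 − uwβ)(1 − uwα)` is nonnegative. -/
lemma star_bracket_nonneg_of_le {u w α β γ : R} (hu0 : 0 ≤ u) (hu1 : u ≤ 1) (hw0 : 0 ≤ w)
    (hw1 : w ≤ 1) (hα0 : 0 ≤ α) (hβ1 : β ≤ 1) (hγα : γ ≤ α) (hαβ : α ≤ β) :
    0 ≤ β * (1 - u * w * α) * (1 - w * β) + α * (1 - u * w * β) * (1 - u * α) -
      γ * (1 - u * w * β) * (1 - u * w * α) := by
  have hβ0 : 0 ≤ β := hα0.trans hαβ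
  have hα1 : α ≤ 1 := hαβ.trans hβ1
  have hwβ : w * β ≤ 1 := by
    have := mul_le_mul_of_nonneg_left hβ1 hw0; linarith
  have huw : u * w ≤ 1 := by
    have := mul_le_mul_of_nonneg_left hw1 hu0; linarith
  have huwβ : u * w * β ≤ 1 := by
    have := mul_le_mul_of_nonneg_left hβ1 (mul_nonneg hu0 hw0); linarith
  have huwα : u * w * α ≤ 1 := by
    have := mul_le_mul_of_nonneg_left hα1 (mul_nonneg hu0 hw0); linarith
  have huα : u * α ≤ 1 := by
    have := mul_le_mul_of_nonneg_left hα1 hu0; linarith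
  -- replace `γ` by `α` (the coefficient of `−γ` is nonnegative)
  have h1 : γ * (1 - u * w * β) * (1 - u * w * α) ≤ α * (1 - u * w * β) * (1 - u * w * α) := by
    have := mul_nonneg (sub_nonneg.2 huwβ) (sub_nonneg.2 huwα)
    nlinarith
  -- the remaining bracket `T = β(1 − uwα)(1 − wβ) − uα²(1 − w)(1 − uwβ)`, decomposed
  have hT : β * (1 - u * w * α) * (1 - w * β) + α * (1 - u * w * β) * (1 - u * α) -
      α * (1 - u * w * β) * (1 - u * w * α) =
      u * w * β * (1 - w * β) * (β - α) +
        (1 - u * w * β) * ((1 - w) * (β - u * α * α) + β * w * (1 - β)) := by ring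
  have t1 : 0 ≤ u * w * β * (1 - w * β) * (β - α) :=
    mul_nonneg (mul_nonneg (mul_nonneg (mul_nonneg hu0 hw0) hβ0) (sub_nonneg.2 hwβ))
      (sub_nonneg.2 hαβ)
  have t2 : 0 ≤ (1 - w) * (β - u * α * α) := by
    have : u * α * α ≤ α := by nlinarith
    exact mul_nonneg (sub_nonneg.2 hw1) (by linarith)
  have t3 : 0 ≤ β * w * (1 - β) := mul_nonneg (mul_nonneg hβ0 hw0) (sub_nonneg.2 hβ1)
  have t4 : 0 ≤ (1 - u * w * β) * ((1 - w) * (β - u * α * α) + β * w * (1 - β)) :=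
    mul_nonneg (sub_nonneg.2 huwβ) (add_nonneg t2 t3)
  linarith

/-- **The star inequality**: for `u, w, α, β, γ ∈ [0, 1]` with `γ ≤ α` and `γ ≤ β`,
`(1 − uwα)(1 − u)wβ + (1 − uwβ)u(1 − w)α ≤ (1 − uwβ)(1 − uwα)(uα + wβ − uwγ)`. -/
theorem star_ineq {u w α β γ : R} (hu0 : 0 ≤ u) (hu1 : u ≤ 1) (hw0 : 0 ≤ w) (hw1 : w ≤ 1)
    (hα0 : 0 ≤ α) (hα1 : α ≤ 1) (hβ0 : 0 ≤ β) (hβ1 : β ≤ 1) (hγα : γ ≤ α) (hγβ : γ ≤ β) :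
    (1 - u * w * α) * ((1 - u) * w * β) + (1 - u * w * β) * (u * (1 - w) * α) ≤
      (1 - u * w * β) * (1 - u * w * α) * (u * α + w * β - u * w * γ) := by
  have key : (1 - u * w * β) * (1 - u * w * α) * (u * α + w * β - u * w * γ) -
      ((1 - u * w * α) * ((1 - u) * w * β) + (1 - u * w * β) * (u * (1 - w) * α)) =
      u * w * (β * (1 - u * w * α) * (1 - w * β) + α * (1 - u * w * β) * (1 - u * α) -
        γ * (1 - u * w * β) * (1 - u * w * α)) := by ring
  have hb : 0 ≤ β * (1 - u * w * α) * (1 - w * β) + α * (1 - u * w * β) * (1 - u * α) -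
      γ * (1 - u * w * β) * (1 - u * w * α) := by
    rcases le_total α β with hαβ | hβα
    · exact star_bracket_nonneg_of_le hu0 hu1 hw0 hw1 hα0 hβ1 hγα hαβ
    · have := star_bracket_nonneg_of_le hw0 hw1 hu0 hu1 hβ0 hα1 hγβ hβα
      linarith [this]
  nlinarith [mul_nonneg (mul_nonneg hu0 hw0) hb]

end Star

/-! ## The events at a two-edge vertex -/

section Events

variable {V : Type*} {E : Type*} [DecidableEq E] {ends : E → Sym2 V} {e₁ e₂ : E}
  {o a₁ a₂ v b : V}

/-- `update ω e false ≤ ω`. -/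
lemma update_false_le (ω : Config E) (e : E) : Function.update ω e false ≤ ω := by
  intro f
  by_cases h : f = e
  · subst h; simp
  · simp [Function.update_of_ne h]

/-- `close2 e₁ e₂ ω ≤ ω`. -/
lemma close2_le (ω : Config E) : close2 e₁ e₂ ω ≤ ω :=
  (update_false_le _ e₂).trans (update_false_le ω e₁)

omit [DecidableEq E] in
/-- `Q` is decreasing. -/
lemma Q_antitone {ω ω' : Config E} (h : ω' ≤ ω) (hQ : ω ∈ avoidAll ends a₂ {a₁}) :
    ω' ∈ avoidAll ends a₂ {a₁} := by
  rw [mem_avoidAll] at hQ ⊢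
  intro x hx hc
  exact hQ x hx (conn_mono h hc)

/-- With `e₁` closed, `close2 ω = update ω e₂ false`. -/
lemma close2_of_left_closed {ω : Config E} (h : ω e₁ = false) :
    close2 e₁ e₂ ω = Function.update ω e₂ false := by
  have i1 : Function.update ω e₁ false = ω := Function.update_eq_self_iff.2 h.symm
  unfold close2
  rw [i1]

/-- With `e₂` closed, `close2 ω = update ω e₁ false`. -/
lemma close2_of_right_closed {ω : Config E} (h : ω e₂ = false) :
    close2 e₁ e₂ ω = Function.update ω e₁ false := by
  unfold close2
  have : (Function.update ω e₁ false) e₂ = false := by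
    by_cases h12 : e₂ = e₁
    · subst h12; simp
    · rw [Function.update_of_ne h12]; exact h
  have i2 : Function.update (Function.update ω e₁ false) e₂ false = Function.update ω e₁ false :=
    Function.update_eq_self_iff.2 this.symm
  exact i2

/-- **`Q ∩ vL ∩ oH` is the pattern «`e₁` closed, `e₂` open» with the `G − v` event `Q ∩ oH ∩ bL`.** -/
lemma vL_oH_eq (h₁ : ends e₁ = s(v, o)) (h₂ : ends e₂ = s(v, b))
    (hstar : ∀ f, v ∈ ends f → f = e₁ ∨ f = e₂) (hvo : v ≠ o) (hvb : v ≠ b) (hv1 : v ≠ a₁)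
    (hv2 : v ≠ a₂) :
    avoidAll ends a₂ {a₁} ∩ (connEvent ends a₁ v ∩ connEvent ends a₂ o) =
      closedEdge e₁ ∩ openEdge e₂ ∩
        pinned e₁ e₂ (avoidAll ends a₂ {a₁} ∩ connEvent ends a₂ o ∩ connEvent ends a₁ b) := by
  ext ω
  simp only [Set.mem_inter_iff, mem_pinned, closedEdge, openEdge, Set.mem_setOf_eq, mem_avoidAll,
    Finset.mem_singleton, forall_eq, mem_connEvent]
  constructor
  · rintro ⟨hQ, hvL, hoH⟩
    have he₁ : ω e₁ = false := by
      by_contra hc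
      have ho : ω e₁ = true := by simpa using hc
      have hvo' : Conn ends ω v o := conn_of_openAdj ⟨e₁, ho, h₁⟩
      exact hQ (conn_trans hoH (conn_symm (conn_trans hvL hvo')))
    have hvb' : ω e₂ = true ∧ Conn ends ω a₁ b := by
      rcases (conn_v_iff h₁ h₂ hstar hv1.symm).1 hvL with ⟨ho, _⟩ | h
      · rw [he₁] at ho; exact absurd ho Bool.false_ne_true
      · exact h
    rw [close2_of_left_closed he₁]
    refine ⟨⟨he₁, hvb'.1⟩, ⟨fun hc => hQ (conn_mono (update_false_le ω e₂) hc), ?_⟩, ?_⟩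
    · exact conn_update_closed_of_conn h₁ h₂ hstar hvb he₁ hv2.symm hvo.symm hoH
    · exact conn_update_closed_of_conn h₁ h₂ hstar hvb he₁ hv1.symm hvb.symm hvb'.2
  · rintro ⟨⟨he₁, he₂⟩, ⟨hQ, hoH⟩, hbL⟩
    rw [close2_of_left_closed he₁] at hQ hoH hbL
    refine ⟨fun hc => hQ ?_, ?_, conn_mono (update_false_le ω e₂) hoH⟩
    · exact conn_update_closed_of_conn h₁ h₂ hstar hvb he₁ hv2.symm hv1.symm hc
    · exact (conn_v_iff h₁ h₂ hstar hv1.symm).2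
        (Or.inr ⟨he₂, conn_mono (update_false_le ω e₂) hbL⟩)

omit [DecidableEq E] in
/-- **`Q ∩ vL ∩ oH ∩ bH = ∅`** (`v ∈ C₁` needs `o ∈ C₁` or `b ∈ C₁`). -/
lemma vL_oH_bH_eq_empty (h₁ : ends e₁ = s(v, o)) (h₂ : ends e₂ = s(v, b))
    (hstar : ∀ f, v ∈ ends f → f = e₁ ∨ f = e₂) (hv1 : v ≠ a₁) :
    avoidAll ends a₂ {a₁} ∩ (connEvent ends a₁ v ∩ (connEvent ends a₂ o ∩ connEvent ends a₂ b)) =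
      ∅ := by
  ext ω
  simp only [Set.mem_inter_iff, mem_avoidAll, Finset.mem_singleton, forall_eq, mem_connEvent,
    Set.mem_empty_iff_false, iff_false, not_and]
  intro hQ hvL hoH hbH
  rcases (conn_v_iff h₁ h₂ hstar hv1.symm).1 hvL with ⟨_, hc⟩ | ⟨_, hc⟩
  · exact hQ (conn_trans hoH (conn_symm hc))
  · exact hQ (conn_trans hbH (conn_symm hc))

/-- **Three disjoint pieces of `Q ∩ oH`**: `e₁` closed with `Q ∩ oH` in `G − v`; `e₁` open and
`e₂` closed with `Q ∩ oH` in `G − v`; both open with `Q ∩ oH ∩ ¬bL` in `G − v`. -/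
lemma oH_superset (h₁ : ends e₁ = s(v, o)) (h₂ : ends e₂ = s(v, b))
    (hstar : ∀ f, v ∈ ends f → f = e₁ ∨ f = e₂) (hvo : v ≠ o) (hvb : v ≠ b) (hv1 : v ≠ a₁)
    (hv2 : v ≠ a₂) (h12 : e₁ ≠ e₂) :
    closedEdge e₁ ∩ pinned e₁ e₂ (avoidAll ends a₂ {a₁} ∩ connEvent ends a₂ o) ∪
        openEdge e₁ ∩ closedEdge e₂ ∩ pinned e₁ e₂ (avoidAll ends a₂ {a₁} ∩ connEvent ends a₂ o) ∪
        openEdge e₁ ∩ openEdge e₂ ∩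
          pinned e₁ e₂ (avoidAll ends a₂ {a₁} ∩ connEvent ends a₂ o ∩ (connEvent ends a₁ b)ᶜ) ⊆
      avoidAll ends a₂ {a₁} ∩ connEvent ends a₂ o := by
  intro ω hω
  simp only [Set.mem_union, Set.mem_inter_iff, mem_pinned, closedEdge, openEdge, Set.mem_setOf_eq,
    Set.mem_compl_iff, mem_connEvent] at hω
  simp only [Set.mem_inter_iff, mem_avoidAll, Finset.mem_singleton, forall_eq, mem_connEvent]
  rcases hω with (⟨he₁, hQ, hoH⟩ | ⟨⟨he₁, he₂⟩, hQ, hoH⟩) | ⟨⟨he₁, he₂⟩, ⟨hQ, hoH⟩, hbL⟩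
  · rw [close2_of_left_closed he₁] at hQ hoH
    rw [mem_avoidAll] at hQ
    simp only [Finset.mem_singleton, forall_eq] at hQ
    refine ⟨fun hc => hQ ?_, conn_mono (update_false_le ω e₂) hoH⟩
    exact conn_update_closed_of_conn h₁ h₂ hstar hvb he₁ hv2.symm hv1.symm hc
  · rw [close2_of_right_closed he₂] at hQ hoH
    rw [mem_avoidAll] at hQ
    simp only [Finset.mem_singleton, forall_eq] at hQ
    refine ⟨fun hc => hQ ?_, conn_mono (update_false_le ω e₁) hoH⟩
    exact conn_update_closed_of_conn h₂ h₁ (fun f hf => (hstar f hf).symm) hvo he₂ hv2.symm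
      hv1.symm hc
  · rw [mem_avoidAll] at hQ
    simp only [Finset.mem_singleton, forall_eq] at hQ
    refine ⟨fun hc => ?_, conn_mono (close2_le ω) hoH⟩
    have hω : Function.update (Function.update ω e₁ true) e₂ true = ω := by
      have i1 : Function.update ω e₁ true = ω := Function.update_eq_self_iff.2 he₁.symm
      rw [i1]
      exact Function.update_eq_self_iff.2 he₂.symm
    rw [← hω] at hc
    rcases conn_of_conn_update_open h₁ h₂ hstar h12 hv2.symm hv1.symm hc with hc' | ⟨_, hc'⟩ |
      ⟨_, hc'⟩
    · exact hQ hc'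
    · exact hbL (conn_symm hc')
    · exact hQ (conn_trans hoH hc')

/-- **Two pieces of `vL`**: `e₁` open with `oL` in `G − v`, and `e₂` open with `bL` in `G − v`. -/
lemma vL_superset (h₁ : ends e₁ = s(v, o)) (h₂ : ends e₂ = s(v, b))
    (hstar : ∀ f, v ∈ ends f → f = e₁ ∨ f = e₂) (hv1 : v ≠ a₁) :
    openEdge e₁ ∩ pinned e₁ e₂ (connEvent ends a₁ o) ∪
        openEdge e₂ ∩ pinned e₁ e₂ (connEvent ends a₁ b) ⊆ connEvent ends a₁ v := by
  intro ω hω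
  simp only [Set.mem_union, Set.mem_inter_iff, mem_pinned, openEdge, Set.mem_setOf_eq,
    mem_connEvent] at hω
  rw [mem_connEvent, conn_v_iff h₁ h₂ hstar hv1.symm]
  rcases hω with ⟨he, hc⟩ | ⟨he, hc⟩
  · exact Or.inl ⟨he, conn_mono (close2_le ω) hc⟩
  · exact Or.inr ⟨he, conn_mono (close2_le ω) hc⟩

/-- `pinned H ∩ pinned H' = pinned (H ∩ H')`. -/
lemma pinned_inter (H H' : Set (Config E)) :
    pinned e₁ e₂ H ∩ pinned e₁ e₂ H' = pinned e₁ e₂ (H ∩ H') := by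
  ext ω; simp only [Set.mem_inter_iff, mem_pinned]

end Events

/-! ## The masses and the sign -/

section Main

variable {V : Type*} {E : Type*} [Fintype E] [DecidableEq E] [Fintype V] [DecidableEq V]
  {R : Type*} [Field R] [LinearOrder R] [IsStrictOrderedRing R]
variable {ends : E → Sym2 V} {p : E → R} {e₁ e₂ : E} {o a₁ a₂ v b : V}

omit [Fintype E] [DecidableEq E] [Fintype V] [DecidableEq V] in
/-- `Q` is a lower set. -/
lemma isLowerSet_Q (ends : E → Sym2 V) (a₁ a₂ : V) : IsLowerSet (avoidAll ends a₂ {a₁}) :=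
  fun _ _ h hQ => Q_antitone h hQ

omit [Fintype V] [DecidableEq V] [LinearOrder R] [IsStrictOrderedRing R] in
/-- **`P(Q, vL, oH) = (1 − u)·w·P₀₀(Q, oH, bL)`.** -/
lemma prob_vL_oH (h₁ : ends e₁ = s(v, o)) (h₂ : ends e₂ = s(v, b))
    (hstar : ∀ f, v ∈ ends f → f = e₁ ∨ f = e₂) (hvo : v ≠ o) (hvb : v ≠ b) (hv1 : v ≠ a₁)
    (hv2 : v ≠ a₂) (h12 : e₁ ≠ e₂) :
    prob p (avoidAll ends a₂ {a₁} ∩ (connEvent ends a₁ v ∩ connEvent ends a₂ o)) =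
      (1 - p e₁) * p e₂ * prob (Function.update (Function.update p e₁ 0) e₂ 0)
        (avoidAll ends a₂ {a₁} ∩ connEvent ends a₂ o ∩ connEvent ends a₁ b) := by
  rw [vL_oH_eq h₁ h₂ hstar hvo hvb hv1 hv2, prob_closed_open_pinned h12]

omit [Fintype V] [DecidableEq V] [LinearOrder R] [IsStrictOrderedRing R] in
/-- **`P(Q, vL, bH) = u·(1 − w)·P₀₀(Q, bH, oL)`** (the mirror of `prob_vL_oH`). -/
lemma prob_vL_bH (h₁ : ends e₁ = s(v, o)) (h₂ : ends e₂ = s(v, b))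
    (hstar : ∀ f, v ∈ ends f → f = e₁ ∨ f = e₂) (hvo : v ≠ o) (hvb : v ≠ b) (hv1 : v ≠ a₁)
    (hv2 : v ≠ a₂) (h12 : e₁ ≠ e₂) :
    prob p (avoidAll ends a₂ {a₁} ∩ (connEvent ends a₁ v ∩ connEvent ends a₂ b)) =
      p e₁ * (1 - p e₂) * prob (Function.update (Function.update p e₁ 0) e₂ 0)
        (avoidAll ends a₂ {a₁} ∩ connEvent ends a₂ b ∩ connEvent ends a₁ o) := by
  have h := vL_oH_eq (ends := ends) (a₁ := a₁) (a₂ := a₂) h₂ h₁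
    (fun f hf => (hstar f hf).symm) hvb hvo hv1 hv2
  rw [h]
  have e : closedEdge e₂ ∩ openEdge e₁ ∩ pinned e₂ e₁ (avoidAll ends a₂ {a₁} ∩ connEvent ends a₂ b ∩
      connEvent ends a₁ o) = openEdge e₁ ∩ closedEdge e₂ ∩ pinned e₁ e₂
        (avoidAll ends a₂ {a₁} ∩ connEvent ends a₂ b ∩ connEvent ends a₁ o) := by
    ext ω
    simp only [Set.mem_inter_iff, mem_pinned, close2, Function.update_comm h12]
    tauto
  rw [e, prob_open_closed_pinned h12]

omit [Fintype V] [DecidableEq V] [LinearOrder R] [IsStrictOrderedRing R] in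
/-- **`P(Q, vL, oH, bH) = 0`.** -/
lemma prob_vL_oH_bH (h₁ : ends e₁ = s(v, o)) (h₂ : ends e₂ = s(v, b))
    (hstar : ∀ f, v ∈ ends f → f = e₁ ∨ f = e₂) (hv1 : v ≠ a₁) :
    prob p (avoidAll ends a₂ {a₁} ∩ (connEvent ends a₁ v ∩ (connEvent ends a₂ o ∩ connEvent ends a₂ b))) =
      0 := by
  rw [vL_oH_bH_eq_empty h₁ h₂ hstar hv1, prob_empty]

omit [Fintype V] [DecidableEq V] in
/-- **`P(Q, oH) ≥ (1 − uw)·P₀₀(Q, oH) + uw·P₀₀(Q, oH, ¬bL)`.** -/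
lemma prob_oH_ge (hp : IsProbVec p) (h₁ : ends e₁ = s(v, o)) (h₂ : ends e₂ = s(v, b))
    (hstar : ∀ f, v ∈ ends f → f = e₁ ∨ f = e₂) (hvo : v ≠ o) (hvb : v ≠ b) (hv1 : v ≠ a₁)
    (hv2 : v ≠ a₂) (h12 : e₁ ≠ e₂) :
    (1 - p e₁ * p e₂) * prob (Function.update (Function.update p e₁ 0) e₂ 0)
        (avoidAll ends a₂ {a₁} ∩ connEvent ends a₂ o) +
      p e₁ * p e₂ * prob (Function.update (Function.update p e₁ 0) e₂ 0)
        (avoidAll ends a₂ {a₁} ∩ connEvent ends a₂ o ∩ (connEvent ends a₁ b)ᶜ) ≤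
      prob p (avoidAll ends a₂ {a₁} ∩ connEvent ends a₂ o) := by
  have hsub := oH_superset (ends := ends) (a₁ := a₁) (a₂ := a₂) h₁ h₂ hstar hvo hvb hv1 hv2 h12
  have hle := prob_mono hp hsub
  have d1 : Disjoint
      (closedEdge e₁ ∩ pinned e₁ e₂ (avoidAll ends a₂ {a₁} ∩ connEvent ends a₂ o))
      (openEdge e₁ ∩ closedEdge e₂ ∩ pinned e₁ e₂ (avoidAll ends a₂ {a₁} ∩ connEvent ends a₂ o)) := by
    rw [Set.disjoint_left]
    rintro ω ⟨h1, _⟩ ⟨⟨h2, _⟩, _⟩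
    simp only [closedEdge, openEdge, Set.mem_setOf_eq] at h1 h2
    rw [h1] at h2; exact Bool.false_ne_true h2
  have d2 : Disjoint
      (closedEdge e₁ ∩ pinned e₁ e₂ (avoidAll ends a₂ {a₁} ∩ connEvent ends a₂ o) ∪
        openEdge e₁ ∩ closedEdge e₂ ∩ pinned e₁ e₂ (avoidAll ends a₂ {a₁} ∩ connEvent ends a₂ o))
      (openEdge e₁ ∩ openEdge e₂ ∩
        pinned e₁ e₂ (avoidAll ends a₂ {a₁} ∩ connEvent ends a₂ o ∩ (connEvent ends a₁ b)ᶜ)) := by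
    rw [Set.disjoint_left]
    rintro ω (⟨h1, _⟩ | ⟨⟨_, h2⟩, _⟩) ⟨⟨h3, h4⟩, _⟩
    · simp only [closedEdge, openEdge, Set.mem_setOf_eq] at h1 h3
      rw [h1] at h3; exact Bool.false_ne_true h3
    · simp only [closedEdge, openEdge, Set.mem_setOf_eq] at h2 h4
      rw [h2] at h4; exact Bool.false_ne_true h4
  rw [prob_union_of_disjoint p d2, prob_union_of_disjoint p d1, prob_closed_pinned' h12,
    prob_open_closed_pinned h12, prob_open_open_pinned h12] at hle
  linarith

omit [Fintype V] [DecidableEq V] in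
/-- **`π_v ≥ u·P₀₀(oL) + w·P₀₀(bL) − uw·P₀₀(oL, bL)`.** -/
lemma prob_vL_ge (hp : IsProbVec p) (h₁ : ends e₁ = s(v, o)) (h₂ : ends e₂ = s(v, b))
    (hstar : ∀ f, v ∈ ends f → f = e₁ ∨ f = e₂) (hv1 : v ≠ a₁) (h12 : e₁ ≠ e₂) :
    p e₁ * prob (Function.update (Function.update p e₁ 0) e₂ 0) (connEvent ends a₁ o) +
        p e₂ * prob (Function.update (Function.update p e₁ 0) e₂ 0) (connEvent ends a₁ b) -
        p e₁ * p e₂ * prob (Function.update (Function.update p e₁ 0) e₂ 0)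
          (connEvent ends a₁ o ∩ connEvent ends a₁ b) ≤
      prob p (connEvent ends a₁ v) := by
  have hle := prob_mono hp (vL_superset (ends := ends) (a₁ := a₁) h₁ h₂ hstar hv1)
  have hu := prob_union_add_prob_inter p (openEdge e₁ ∩ pinned e₁ e₂ (connEvent ends a₁ o))
    (openEdge e₂ ∩ pinned e₁ e₂ (connEvent ends a₁ b))
  have e : openEdge e₁ ∩ pinned e₁ e₂ (connEvent ends a₁ o) ∩
      (openEdge e₂ ∩ pinned e₁ e₂ (connEvent ends a₁ b)) =
      openEdge e₁ ∩ openEdge e₂ ∩ pinned e₁ e₂ (connEvent ends a₁ o ∩ connEvent ends a₁ b) := by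
    rw [← pinned_inter]; ext ω; simp only [Set.mem_inter_iff]; tauto
  rw [e, prob_open_pinned' h12, prob_open_pinned'' h12, prob_open_open_pinned h12] at hu
  linarith

end Main

end LeafRowPendantRootStarMasses

end Summit.Ventures.PercRepro2
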